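import Summits.ResolutionOfSingularities.ResolutionOfSingularities.Theorems.EquisingularLiftEquisingularLiftNatNoseResidueTopLocus
import Summits.ResolutionOfSingularities.ResolutionOfSingularities.Theorems.EquisingularLiftEquisingularLiftNatLiftableNoseClass2ThenPoints
import Summits.ResolutionOfSingularities.ResolutionOfSingularities.Theorems.EquisingularLiftEquisingularLiftNatCompleteIntersectionLiftSmooth
import Summits.ResolutionOfSingularities.ResolutionOfSingularities.Theorems.EquisingularLiftEquisingularLiftNatCompleteIntersectionLiftKey
import Summits.ResolutionOfSingularities.ResolutionOfSingularities.Theorems.EquisingularLiftEquisingularLiftNatCompleteIntersectionLiftJacobian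
import Summits.ResolutionOfSingularities.ResolutionOfSingularities.Theorems.EquisingularLiftEquisingularLiftNatDeterminantalLiftDownstairs
import Summits.ResolutionOfSingularities.ResolutionOfSingularities.Theorems.EquisingularLiftEquisingularLiftNatHilbertBurchHomogeneous
import Literature.AlgebraicGeometry.Resolution.BlowupDisjointCentreSplitting
import HarnessLib

/-!
# [OURS · L1 W4.5(b) · EL♮(3)] NOSE RESIDUE STRUCTURE, brick 3 — every liftable-class₂ nose is a REGULAR scheme; hence branch (B) of the
# singular-curve dichotomy contains every `H` whose singular curve is itself singular

Cell `res-hironaka`, rung L, slot W4.5(b), D-0157 DOOR 1 width seat `res-L1-w45b-nose-w4` (desk WIDTH TABLE D1 row nose-w4, desk word (ii));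
crux CHILD EL♮(3) = stmt-ResolutionOfSingularities-20148 (parent EL♮ stmt-…-20038). OURS; NOT a statement of any manuscript; nothing of
[Hironaka2017] is asserted or used; AI kernel work, weaker than expert review. Resolution of singularities in positive characteristic is NOT proved here
(dimension 3 is a theorem in print, Cossart–Piltant 2008/2009). No `sorry`, no new definition, no instance, no notation; standard axioms.
`--kind proof --supports stmt-ResolutionOfSingularities-20148 --as helper`.  Sister files: `…NatNoseResidueUnfold` (1a), `…NatNoseResidueCore` (1b),
`…NatNoseResidueTopLocus` (2).

* `isRegular_subscheme_vanishingIdeal_of_isLiftableNoseClass` — every member `Z` of lead-2's v1 class (smooth complete intersections, smooth determinantal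
  loci, disjoint unions) carries a REGULAR reduced subscheme `V(𝓘_Z)`: the ci case is res-type-051's `CILift.isRegular_subscheme_projIdealSheaf_of_jacobian`
  transported along hKEY exactness `CILift.projIdealSheaf_span_eq_vanishingIdeal` ((J′) from the Jacobian clause by `CILift.downstairs_of_jacobianMinor`); the
  det case is `DetLift.isRegular_subscheme_projIdealSheaf_rowMinors` along `DetLift.projIdealSheaf_rowMinors_eq_vanishingIdeal` ((J′-pair) by
  `DetLift.pairDown_of_jacobianPair`); disjoint unions by `vanishingIdeal_sup_eq_mul_of_disjoint` + `isRegular_subscheme_mul_of_disjoint_support`.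
* `isRegular_subscheme_vanishingIdeal_of_isLiftableNoseClass₂` — the same for the level-2 class (`rat` by res-type-051's T-RATREG
  `RatReg.isRegular_subscheme_vanishingIdeal_of_clause'`).  `k` any field.
* `not_isLiftableNoseClass₂_of_not_isRegular` — contrapositive: a closed `Z` whose reduced subscheme is NOT regular is in NEITHER nose class.
* `nose_residue_singularCurve_trichotomy_three` — at `n = 3`, under `¬ NoseHypLiftClassTwo`, for a residue `H` (integral, `ι : H ↪ ℙ³_k` closed immersion,
  not regular, infinitely many non-regular points) there is a singular curve `Z` (closed irreducible infinite, `Z ⊆ ι(Sing H)`, `ι(H) ⊄ Z`, curve clause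
  `dim 𝒪_{Z̃,z} = 1` at closed points) and EITHER
  (A) `Z` is class₂ — then `Z̃` is a REGULAR curve and no blow-up of `Z` has a regular reduced strict transform of `H` (persistence along a smooth liftable
      curve), OR
  (B1) `Z̃` is regular but `Z` is not class₂ (a smooth curve outside the liftable classes: LIFT(Z) territory, CRUX-PLAN §1.4), OR
  (B2) `Z̃` is NOT regular (the singular curve of `H` is itself singular — then it is in no nose class at all; companions / multiple structures /
      point steps at its singular points come first, CRUX-PLAN §1.5–§1.7).
-/

set_option linter.dupNamespace false

noncomputable section

open CategoryTheory CategoryTheory.Limits AlgebraicGeometry TopologicalSpace Topology IsLocalRing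
open MvPolynomial HomogeneousLocalization
open Literature.AlgebraicGeometry.Resolution
open Literature.AlgebraicGeometry.Motives
open AlgebraicGeometry.Scheme.IdealSheafData
open Summit.ResolutionOfSingularities.ResolutionOfSingularities.Cruxes.EquisingularLift.StrataSplit

namespace Summit.ResolutionOfSingularities.ResolutionOfSingularities.Cruxes.EquisingularLiftNat.Sections

/-! ## §1 Disjoint unions of regular reduced closed subschemes -/

/-- The reduced subscheme on a DISJOINT union of two closed sets with regular reduced subschemes is regular (`𝓘(Z₁ ∪ Z₂) = 𝓘(Z₁)·𝓘(Z₂)` for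
disjoint `Z₁, Z₂`, and a product of ideal sheaves with disjoint supports and regular subschemes has a regular subscheme). [folklore] -/
theorem isRegular_subscheme_vanishingIdeal_union_of_disjoint {X : Scheme.{0}} [IsLocallyNoetherian X] {Z₁ Z₂ : Set X}
    (h₁ : IsClosed Z₁) (h₂ : IsClosed Z₂) (hreg₁ : Scheme.IsRegular (vanishingIdeal (⟨Z₁, h₁⟩ : Closeds X)).subscheme)
    (hreg₂ : Scheme.IsRegular (vanishingIdeal (⟨Z₂, h₂⟩ : Closeds X)).subscheme) (hdisj : Z₁ ∩ Z₂ = ∅) (h₁₂ : IsClosed (Z₁ ∪ Z₂)) :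
    Scheme.IsRegular (vanishingIdeal (⟨Z₁ ∪ Z₂, h₁₂⟩ : Closeds X)).subscheme := by
  have hd : Disjoint Z₁ Z₂ := Set.disjoint_iff_inter_eq_empty.mpr hdisj
  have hsup : (⟨Z₁ ∪ Z₂, h₁₂⟩ : Closeds X) = (⟨Z₁, h₁⟩ : Closeds X) ⊔ ⟨Z₂, h₂⟩ := Closeds.ext (by simp [Closeds.coe_sup])
  rw [hsup, vanishingIdeal_sup_eq_mul_of_disjoint (Z₁ := ⟨Z₁, h₁⟩) (Z₂ := ⟨Z₂, h₂⟩) hd]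
  refine isRegular_subscheme_mul_of_disjoint_support hreg₁ hreg₂ ?_
  rw [Scheme.IdealSheafData.coe_support_vanishingIdeal, Scheme.IdealSheafData.coe_support_vanishingIdeal]
  exact hd

/-! ## §2 Every liftable-class nose is a regular scheme -/

/-- **Every member of lead-2's liftable nose class (v1) has a REGULAR reduced subscheme** (`k` any field): smooth complete intersections by CI-JAC
(res-type-051), smooth determinantal loci by the Eagon–Northcott/Jacobian-pair package (res-type-097/res-D-pv-027 lineage), disjoint unions by §1.
[cite: Matsumura1987, Thm. 14.2 and Thm. 30.4; StacksProject, Tag 02IS] -/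
theorem isRegular_subscheme_vanishingIdeal_of_isLiftableNoseClass (k : Type) [Field k] (n : ℕ)
    {Z : Set (projectiveSpace n k).left} (h : IsLiftableNoseClass k n Z) (hZ : IsClosed Z) :
    Scheme.IsRegular (vanishingIdeal (⟨Z, hZ⟩ : Closeds (projectiveSpace n k).left)).subscheme := by
  letI := MvPolynomial.gradedAlgebra (σ := Fin (n + 1)) (R := k)
  haveI : IsNoetherian (projectiveSpace n k).left :=
    (isNoetherian_and_isQuasiExcellent_of_isClosedImmersion_projectiveSpace n (𝟙 (projectiveSpace n k).left)).1
  induction h with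
  | ci c f d h =>
    obtain ⟨hdeg, -, hjac, hSig⟩ := h
    have hf : ∀ l, f l ∈ homogeneousSubmodule (Fin (n + 1)) k (d l) := fun l => (hdeg l).2
    have hjac' : ∀ y : Proj (homogeneousSubmodule (Fin (n + 1)) k), (∀ l, f l ∈ y.asHomogeneousIdeal) →
        ∃ e : Fin c ↪ Fin (n + 1), (Matrix.of fun i j => pderiv (e j) (f i)).det ∉ y.asHomogeneousIdeal :=
      fun y hy => hjac y hy
    have hJ' : ∀ y ∈ ((projIdealSheaf (homogeneousSubmodule (Fin (n + 1)) k)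
        ⟨Ideal.span (Set.range f), isHomogeneous_span_of_forall_mem _ f d hf⟩).support :
          Set (Proj (homogeneousSubmodule (Fin (n + 1)) k))),
        ∃ (i : Fin (n + 1)) (hyi : y ∈ Proj.basicOpen (homogeneousSubmodule (Fin (n + 1)) k) (X i)),
          ∀ b : Fin c → (Proj (homogeneousSubmodule (Fin (n + 1)) k)).presheaf.stalk y,
            ∑ l, b l * ((Proj (homogeneousSubmodule (Fin (n + 1)) k)).presheaf.germ
                (Proj.basicOpen (homogeneousSubmodule (Fin (n + 1)) k) (X i)) y hyi).hom
              ((Proj.awayToSection (homogeneousSubmodule (Fin (n + 1)) k) (X i)).hom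
                (mk₁ (homogeneousSubmodule (Fin (n + 1)) k) (CILift.X_mem_one' i) (d l) (f l) (hf l))) ∈
              maximalIdeal ((Proj (homogeneousSubmodule (Fin (n + 1)) k)).presheaf.stalk y) ^ 2 →
            ∀ l, b l ∈ maximalIdeal ((Proj (homogeneousSubmodule (Fin (n + 1)) k)).presheaf.stalk y) := by
      intro y hy
      rw [CILift.support_projIdealSheaf_span f d hf] at hy
      exact CILift.downstairs_of_jacobianMinor f d hf y hy (hjac' y hy)
    have hreg := CILift.isRegular_subscheme_projIdealSheaf_of_jacobian f d hf hjac'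
    rw [CILift.projIdealSheaf_span_eq_vanishingIdeal f d hf hJ' hSig] at hreg
    exact hreg
  | det t M α β h =>
    obtain ⟨hM, hjac, hSig⟩ := h
    have hΔ : ∀ l : Fin (t + 1), (fun l => (M.submatrix l.succAbove id).det) l ∈
        homogeneousSubmodule (Fin (n + 1)) k ((fun l : Fin (t + 1) => ∑ i, α (l.succAbove i) + ∑ j, β j) l) :=
      fun l => det_submatrix_succAbove_mem_homogeneousSubmodule M hM l
    have hJ := DetLift.pairDown_of_jacobianPair (fun l => (M.submatrix l.succAbove id).det)
      (fun l : Fin (t + 1) => ∑ i, α (l.succAbove i) + ∑ j, β j) hΔ (fun y hy => hjac y hy)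
    have hreg := DetLift.isRegular_subscheme_projIdealSheaf_rowMinors M (fun l => (M.submatrix l.succAbove id).det) (fun _ => rfl)
      (fun l : Fin (t + 1) => ∑ i, α (l.succAbove i) + ∑ j, β j) hΔ hJ
    rw [DetLift.projIdealSheaf_rowMinors_eq_vanishingIdeal M (fun l => (M.submatrix l.succAbove id).det) (fun _ => rfl)
      (fun l : Fin (t + 1) => ∑ i, α (l.succAbove i) + ∑ j, β j) hΔ hJ hSig] at hreg
    exact hreg
  | union Z₁ Z₂ h₁ h₂ hdisj ih₁ ih₂ =>
    exact isRegular_subscheme_vanishingIdeal_union_of_disjoint h₁.isClosed h₂.isClosed (ih₁ h₁.isClosed) (ih₂ h₂.isClosed) hdisj _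

/-- **Every member of the liftable nose class₂ has a REGULAR reduced subscheme** (`k` any field): `base` by the v1 theorem, `rat` (closed-immersion images
of `ℙ^r_k` by forms of one degree, cofinite clause) by T-RATREG, disjoint unions by §1.  So a class₂ nose is always a SMOOTH centre downstairs.
[cite: Hartshorne1977, II Prop. 5.9; StacksProject, Tag 02IS] -/
theorem isRegular_subscheme_vanishingIdeal_of_isLiftableNoseClass₂ (k : Type) [Field k] (n : ℕ)
    {Z : Set (projectiveSpace n k).left} (h : IsLiftableNoseClass₂ k n Z) (hZ : IsClosed Z) :
    Scheme.IsRegular (vanishingIdeal (⟨Z, hZ⟩ : Closeds (projectiveSpace n k).left)).subscheme := by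
  letI := MvPolynomial.gradedAlgebra (σ := Fin (n + 1)) (R := k)
  haveI : IsNoetherian (projectiveSpace n k).left :=
    (isNoetherian_and_isQuasiExcellent_of_isClosedImmersion_projectiveSpace n (𝟙 (projectiveSpace n k).left)).1
  induction h with
  | base Z h => exact isRegular_subscheme_vanishingIdeal_of_isLiftableNoseClass k n h hZ
  | rat r e m₀ f h =>
    obtain ⟨hf, he, hcl⟩ := h
    exact RatReg.isRegular_subscheme_vanishingIdeal_of_clause' f he hf hcl _ hZ rfl
  | union Z₁ Z₂ h₁ h₂ hdisj ih₁ ih₂ =>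
    exact isRegular_subscheme_vanishingIdeal_union_of_disjoint h₁.isClosed h₂.isClosed (ih₁ h₁.isClosed) (ih₂ h₂.isClosed) hdisj _

/-- The `redSub` spelling: the reduced closed subscheme `Z̃ = redSub ℙⁿ_k Z hZ` of a class₂ nose is regular. [folklore] -/
theorem isRegular_redSub_of_isLiftableNoseClass₂ (k : Type) [Field k] (n : ℕ)
    {Z : Set (projectiveSpace n k).left} (h : IsLiftableNoseClass₂ k n Z) (hZ : IsClosed Z) :
    Scheme.IsRegular (redSub (projectiveSpace n k).left Z hZ) :=
  isRegular_subscheme_vanishingIdeal_of_isLiftableNoseClass₂ k n h hZ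

/-- **Contrapositive: a closed set whose reduced subscheme is NOT regular lies in neither nose class.** [folklore] -/
theorem not_isLiftableNoseClass₂_of_not_isRegular (k : Type) [Field k] (n : ℕ)
    {Z : Set (projectiveSpace n k).left} (hZ : IsClosed Z) (hreg : ¬ Scheme.IsRegular (redSub (projectiveSpace n k).left Z hZ)) :
    ¬ IsLiftableNoseClass₂ k n Z ∧ ¬ IsLiftableNoseClass k n Z :=
  ⟨fun h => hreg (isRegular_redSub_of_isLiftableNoseClass₂ k n h hZ),
    fun h => hreg (isRegular_redSub_of_isLiftableNoseClass₂ k n (IsLiftableNoseClass₂.base Z h) hZ)⟩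

/-! ## §3 The singular-curve trichotomy at `n = 3` -/

/-- **THE SINGULAR-CURVE TRICHOTOMY of the nose residue at `n = 3`.** Under `¬ NoseHypLiftClassTwo k 3 H ι`, for an integral non-regular closed
`ι : H ↪ ℙ³_k` with infinitely many non-regular points there is a singular curve `Z` of `H` (closed, irreducible, infinite, `Z ⊆ ι(Sing H)`, `ι(H) ⊄ Z`,
curve clause at closed points) such that EITHER
(A) `Z` is class₂, `Z̃` is a REGULAR curve, and NO blow-up of `Z` has a regular reduced strict transform of `H`; OR
(B1) `Z̃` is regular but `Z` is NOT class₂ (nor v1-class); OR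
(B2) `Z̃` is NOT regular — and then `Z` is in no nose class.
[OURS · L1 W4.5b · pure logic over bricks 1b/2/3] -/
theorem nose_residue_singularCurve_trichotomy_three (k : Type) [Field k] [IsAlgClosed k] (H : Scheme.{0})
    (ι : H ⟶ (projectiveSpace 3 k).left) [IsClosedImmersion ι] [IsIntegral H]
    (hH : ¬ Literature.AlgebraicGeometry.Resolution.Scheme.IsRegular H)
    (hinf : ¬ Set.Finite {x : H | ¬ IsRegularLocalRing (H.presheaf.stalk x)}) (hlc2 : ¬ NoseHypLiftClassTwo k 3 H ι) :
    ∃ (Z : Set (projectiveSpace 3 k).left) (hZ : IsClosed Z), IsIrreducible Z ∧ Z.Infinite ∧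
      Z ⊆ ι '' {x : H | ¬ IsRegularLocalRing (H.presheaf.stalk x)} ∧ Z ⊆ Set.range ι ∧ ¬ (Set.range ι ⊆ Z) ∧
      (∀ z : ↥(redSub (projectiveSpace 3 k).left Z hZ), IsClosed ({z} : Set ↥(redSub (projectiveSpace 3 k).left Z hZ)) →
        ringKrullDim ((redSub (projectiveSpace 3 k).left Z hZ).presheaf.stalk z) = ((1 : ℕ) : WithBot ℕ∞)) ∧
      ((IsLiftableNoseClass₂ k 3 Z ∧ Scheme.IsRegular (redSub (projectiveSpace 3 k).left Z hZ) ∧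
          ∀ (F₂ : Scheme.{0}) (υ : F₂ ⟶ (projectiveSpace 3 k).left),
            IsBlowup υ (vanishingIdeal (⟨Z, hZ⟩ : Closeds (projectiveSpace 3 k).left)) →
            ¬ Literature.AlgebraicGeometry.Resolution.Scheme.IsRegular
              (vanishingIdeal (⟨closure (υ ⁻¹' (Set.range ι \ Z)), isClosed_closure⟩ : Closeds F₂)).subscheme) ∨
        (Scheme.IsRegular (redSub (projectiveSpace 3 k).left Z hZ) ∧ ¬ IsLiftableNoseClass₂ k 3 Z ∧ ¬ IsLiftableNoseClass k 3 Z) ∨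
        (¬ Scheme.IsRegular (redSub (projectiveSpace 3 k).left Z hZ) ∧ ¬ IsLiftableNoseClass₂ k 3 Z ∧ ¬ IsLiftableNoseClass k 3 Z)) := by
  obtain ⟨Z, hZc, hZirr, hZinf, hZS, hZr, hZn, hcurve⟩ := exists_singularCurve_three k H ι hH hinf
  refine ⟨Z, hZc, hZirr, hZinf, hZS, hZr, hZn, hcurve, ?_⟩
  by_cases hcls : IsLiftableNoseClass₂ k 3 Z
  · exact Or.inl ⟨hcls, isRegular_redSub_of_isLiftableNoseClass₂ k 3 hcls hZc, fun F₂ υ hυ =>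
      not_isRegular_noseStrictTransform_of_not_noseHypLiftClassTwo k 3 H ι hlc2 Z hZc hcls hZr hZn F₂ υ hυ⟩
  · by_cases hreg : Scheme.IsRegular (redSub (projectiveSpace 3 k).left Z hZc)
    · exact Or.inr (Or.inl ⟨hreg, hcls, fun h => hcls (IsLiftableNoseClass₂.base Z h)⟩)
    · exact Or.inr (Or.inr ⟨hreg, not_isLiftableNoseClass₂_of_not_isRegular k 3 hZc hreg⟩)

end Summit.ResolutionOfSingularities.ResolutionOfSingularities.Cruxes.EquisingularLiftNat.Sections

end
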